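import Mathlib
import HarnessLib
import HarnessLib.Audit
import Summits.QuantumAdvantage.QuantumAdvantage.Theorems.NamingDialA
import Summits.QuantumAdvantage.QuantumAdvantage.Theses.DWalkThree
import Summits.QuantumAdvantage.QuantumAdvantage.Theorems.DWalkThreeRingBShot3
import Summits.QuantumAdvantage.QuantumAdvantage.Theorems.DWalkThreeRingFixedBellsSharp3

/-!
# NamingDial, part D/4 (§4: the node equation — `closes` BY NAME onto DWalkThree.RingDenseResidualLt3) — support for item stmt-QuantumAdvantage-22907 (`Theses.DWalkThree.RingDenseResidualLt3`)

Cell decomp-qadv, seat lens-1 («grading / quantitative ladder»), generation 17 — land port of the node «NamingDial» (published under the cell's HOME/decomp-qadv-lens-1/g17/NamingDial.lean, record NODE-g17.md; RESIDUAL MODE on DWalkThree:22907). The node file with ONLY the namespace renamed `Theses.NamingDial → Theorems.NamingDial` and split at section boundaries into parts A–D (A, B, C independent; part D imports part A and alone imports the route file Theses.DWalkThree for the BY-NAME `closes`).  Prop-defs = the node's hardness predicate `ExclusionTwoThirds3` (part A, PROVED there), the counting functions `listing`/`wins` and explicit strategies (parts B, C), and the declared residual `NamingLift3` (part D).  Tree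 facts reused by name, not restated: `DWalk.predHardDWB3`, `two_pow_le_card_odd_class`, `card_odd_filter_le`, `three_mul_card_affine_mod_three`, `stake_eq_affine`, `dk3_eq_one_iff`, `Coset21.oddOneOutForm_holds`, `wtPrefix_zero`, `ConstBells.wtPrefix_self`, `Coset21.wtPrefix_succ`, `RigidityLaws.wtPrefix_one`, `Theorems.dWalkThree_ringFixedBellsSharp3`, `Theorems.dWalkThree_ringBShot3`.  No `sorry`, no new axioms, no instances, no notation.

THIS PART (alone imports the route file; needs part A only): `NamingLift3` (declared residual ≡ the item given the tree), `closes`, `closes'`, `lift_of_target`.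

NODE SYNOPSIS (all parts):

# NamingDial — lens-1 (grading / quantitative ladder) node, cell `decomp-qadv`, generation 17

TARGET (blocker, by name): `Theses.DWalkThree.RingDenseResidualLt3` (stmt-QuantumAdvantage-22907)
`= RingFixedBellsSharp3 → RingBShot3 → RingHardOdd 3`, both hypotheses PROVED in the tree, so the item is
`RingHardOdd 3` (T): Bob's polylog-degree `𝔽₃` strategies win the mod-3 ring game on at most `θ·2^{n-1}` odd inputs.

THE DIAL.  Grade a strategy by HOW MUCH IT MUST NAME.  By the tree's odd-one-out form T′
(`Coset21.oddOneOutForm_holds`) every strategy `y` wins on `u` iff `nae₀ y u ∧ wt u ≢ −c − oddOneOut y u (mod 3)`: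
winning IS excluding one value of the secret `W = |u| mod 3`, the excluded value being named by the REFEREE-assisted
colouring `u ↦ −c − oddOneOut y u` (computed from the hidden class parities).  The rungs, weakest player first:

* E1 DEFINABLE NAMING  — the player himself outputs a polylog-degree `𝔽₃`-colouring `g` and wins iff `g x ≠ D_k x`.
* E2 ONE BLIND BET      — one bell at a fixed cut, rung adaptively (`OneBellDWB3`, PROVED in tree).
* E3 FEW BLIND BETS     — `≤ N^{1/4}` ringing bells (`BShotDWB3`, PROVED in tree).
* E4 MANY BLIND BETS    — all polylog strategies = T.

LAWS PROVED IN THIS FILE (0 sorry):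

* L1 `exclusionTwoThirds3` (rung E1, NEW): no polylog `𝔽₃`-colouring EXCLUDES the stake `D_k` on more than
  `(2/3+ε)` of the odd class — from the tree's prediction law `DWalk.predHardDWB3` by the shift pigeonhole
  `{g ≠ D} = {g+1 = D} ⊔ {g+2 = D}`.  SHARP: `exclusion_sharp` — the constant colouring `1` (degree 0) excludes `D_k` on
  `≥ (2^N − 2)/3` odd inputs (`three_mul_card_dk3_eq_one_le`, the upper twin of the tree's odd-class equidistribution).
* L2 `exchangeLaw`: for EVERY strategy, `#wins_c(y) = Λ₁ + Λ₂`, `Λ_j = #{u : nae₀ ∧ wt u + c + oddOneOut ≡ j}` —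
  wins and correct "listings" of `W` are the same currency at rate ≤ 2 (`listing_le_wins`, `wins_le_two_max`).
* L3 `endpointPair_concentrated` (+ `endpointPair_win_iff`): the degree-0 strategy firing cuts `0` and `n` puts ALL its
  wins on ONE residue (`wt u + c + oddOneOut ≡ c + 2n`) and wins iff `c ≢ n ∧ n + W ≢ 0` (≈ 2/3 of inputs): the listing
  rate `max_j Λ_j / 2ⁿ` already reaches `2/3` at degree 0, so NO listing threshold `π < 2/3` holds and the factor-2
  exchange cannot carry a bound below `T` — the «ListingDial» door is CLOSED (instrument `g17/exp/listing.py`, n ≤ 8: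
  exchange-law violations 0; max listing 0.664 at Y = {0,n}; max win 0.75, 0.6875, 0.672 for n = 3‥8).
* L4 `promise_one` / `promise_two_wins`: give the player ONE value that `W` is NOT and the game collapses — on a promise
  class `{W ≡ r}` a constant single cut wins EVERY input (degree 0), and on `{W ≢ r₀}` the strategy «first cut of prefix
  class `−c−r₀` among the first `K`» wins every input whose class walk hits that class before `K` (all but a `2^{1-K}`
  fraction: `avoid_forces_prefix`).  The hardness of T is exactly the LAST trit: input partitions by the hidden class
  (σ-promise / monodromy classes, `g17/exp/fullclass.py`: the identity-monodromy FULL class is won by `tGuess` w.p. 1.000,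
  N = 4‥10) are classically trivial — the «PromiseDial» door is CLOSED.

NODE EQUATION (honest LADDER; no route requested):
  `RingDenseResidualLt3 ⟸ ExclusionTwoThirds3 [E1 · WEAKER · PROVED here] ∧ NamingLift3 [E1 → RingHardOdd 3 · ≡ T given E1 ·
  IDEA-NEEDED: a two-moduli correlation bound for MANY blind bets]` — `closes` below, by name.  The residual is the blocker
  itself; what this generation adds is the proved rung BELOW the one-bell law and two door-closing laws (L3, L4) with
  kernel witnesses, so that later lens-1 seats do not re-open the listing-threshold or promise-class dials.

WHY EACH PIECE IS STRICTLY WEAKER / EQUIVALENT.  E1 is a theorem (this file) while T is open (probe P1 `E1 → T` fails);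
informally E1 sits below E3 (a named exclusion `W ≠ E(u)` turns into a ≤ 1-ringing-bell strategy — the u-coordinate construction
is `promise_two_wins` with `r₀ :=` the named value); `NamingLift3` is T itself given E1 (declared, not hidden: `lift_of_target`).  WHY NOVEL relative to the other five lenses: no other node grades by the information the player
must NAME (exclusion vs blind bet), none has the exchange identity `wins = Λ₁ + Λ₂` or the promise-collapse law; lens-2
(BlindLoss/pointer readers), lens-3 (Quartic/Perceptron), lens-4 (Unity/Live), lens-5 (Grade/Corner/Restriction), lens-6
(Null/Slice/Orbit) grade strategies or inputs by algebraic shape, not by naming power.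

REPAIR CENSUS (doors tried this generation and why each is closed — evidence in `g17/NODE-g17.md`): degree / depth / prime
gradings (nested ⇒ LADDER, g14–g16); locality by partition (win-neutral scrambling, g15 law) and by domination
(`ringLocal_polylog_lt3` already PROVES the polylog-radius local law ⇒ residual ≡ T); listing threshold (L3 above);
law-shape dial on `wt u + oddOneOut` (a sure value ≠ −c IS near-perfect play ≡ ¬T); promise / monodromy classes (L4);
density-hurts (false: win-neutral gated triples); charge split (three-charge identity ⇒ similar subcases); XOR / direct
product (returns to the untyped (D3-core′)); (degree, sparsity) bi-grading (next rungs are items 27655 / PerfectDial).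
-/

namespace Summit.QuantumAdvantage.QuantumAdvantage.Theorems.NamingDial

set_option linter.dupNamespace false

open Classical
open Finset
open Summit.QuantumAdvantage.AdviceFreeQNC0
open Literature.Computability.MetaComplexity Literature.Computability.MetaComplexity.Smolensky

/-! ## §4  Node equation (honest LADDER) — `closes` by name -/

/-- **Residual `NamingLift3`** (≡ T given E1 — DECLARED, not hidden; IDEA-NEEDED: an average-case two-moduli bound for MANY
blind bets, the (D3-core′) / CDH-type input the route names): the lift from definable naming to all polylog strategies. -/
def NamingLift3 : Prop :=
  ExclusionTwoThirds3 → Summit.QuantumAdvantage.AdviceFreeQNC0.RingHardOdd 3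

/-- **closes** — the node decides the blocker BY NAME: `E1 ∧ NamingLift3 ⟹ DWalkThree.RingDenseResidualLt3`. -/
theorem closes (h₁ : ExclusionTwoThirds3) (h₂ : NamingLift3) :
    Summit.QuantumAdvantage.QuantumAdvantage.Theses.DWalkThree.RingDenseResidualLt3 :=
  fun _ _ => h₂ h₁

/-- the node with its proved rung discharged: only the lift remains. -/
theorem closes' (h₂ : NamingLift3) :
    Summit.QuantumAdvantage.QuantumAdvantage.Theses.DWalkThree.RingDenseResidualLt3 :=
  closes exclusionTwoThirds3 h₂

/-- conversely the blocker gives the lift (so `NamingLift3 ⟺ 22907` given the tree: an honest EQUIV, the split beneath it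
being E1 (WEAKER, proved) — recorded so that no later seat mistakes the lift for progress). -/
theorem lift_of_target
    (hT : Summit.QuantumAdvantage.QuantumAdvantage.Theses.DWalkThree.RingDenseResidualLt3) : NamingLift3 :=
  fun _ => hT Summit.QuantumAdvantage.QuantumAdvantage.Theorems.dWalkThree_ringFixedBellsSharp3
    Summit.QuantumAdvantage.QuantumAdvantage.Theorems.dWalkThree_ringBShot3

end Summit.QuantumAdvantage.QuantumAdvantage.Theorems.NamingDial
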